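import Summits.Schanuel.Schanuel.Theorems.RootDecomp1EScaleTransfer04

/-!
# RootDecomp1EScaleTransfer — lens 2, generation 35 «SCALE-TRANSFER CELL» (ScaleTransfer.lean bf37e395…, 1670 l) — continuation (RootDecomp1EScaleTransfer05): §5d robustness — EVERY ℚ-free tuple inside the line `ξ_Q · ℚ(√2, i)` is in the scale class (`xiQ_approx_robust`, `ωd`, `yR`, `MR`, `latticeR`, `hyperScaleApprox_xiQ_R`, `inScaleClass_of_mem_span_zQ4`, `schanuel_on_line_zQ4`, `ih_at_zQ4`, `item31409_applied_at_zQ4'`)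

(lens-2 g35 `ScaleTransfer.lean`, sha256 bf37e395…8f98, own farm rc 0 · 0 sorry · axioms std; critic VERDICT STATUS L1636 (d) PORT GO LOW;
port by census-1 gen 15 in five parts `RootDecomp1EScaleTransfer01`–`05` — see the PORT NOTE of part 01; `--supports stmt-Schanuel-31409`; rung 0.)
-/

noncomputable section

open Complex IntermediateField
open Summit.Schanuel.Schanuel.Theorems.RootDecomp1KHyper (LWMeasure SB SFset mvlen mvlen_nonneg
  abs_coeff_le_mvlen one_le_mvlen exists_int_mul_eq_map mvaeval_int_map sb_of_algebraicIndependent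
  mem_adjoin_SFset_I' form_ne_zero_of_linearIndependent)

namespace Summit.Schanuel.Schanuel.Theorems.RootDecomp1EScaleTransfer

variable {D n : ℕ}

/-! ### §5d Robustness: EVERY ℚ-free tuple inside the line `ξ_Q · ℚ(√2, i)` is in the scale class

Consequently the induction binder of item 31409 at `z_Q⁽⁴⁾` is DISCHARGED (mod `hLW`), and `S` holds on
every ℚ-free tuple drawn from the ℚ-span of `z_Q⁽⁴⁾` (any length). -/

/-- Robust approximation: level `μ` is served by the approximant of index `μ (L+1)` whenever the
order-lattice data are at most `3 ^ L`-fold larger than for `ω₄` itself. -/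
theorem xiQ_approx_robust (L μ : ℕ) {s : ℝ} (hs0 : 0 ≤ s)
    (hs : s ≤ (3 : ℝ) ^ (texp (μ * (L + 1)) + 1 + L)) :
    |xiQ - gamQ (μ * (L + 1))| < Real.exp (-Real.exp (s ^ μ)) := by
  have hnat : (texp (μ * (L + 1)) + 1 + L) * μ ≤ (texp (μ * (L + 1)) + 5) * (μ * (L + 1)) := by
    have h1 : texp (μ * (L + 1)) + 1 + L ≤ (texp (μ * (L + 1)) + 5) * (L + 1) := by nlinarith
    calc (texp (μ * (L + 1)) + 1 + L) * μ ≤ (texp (μ * (L + 1)) + 5) * (L + 1) * μ :=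
          Nat.mul_le_mul_right _ h1
      _ = (texp (μ * (L + 1)) + 5) * (μ * (L + 1)) := by ring
  rw [abs_of_nonneg (xiQ_sub_gamQ_nonneg _)]
  calc xiQ - gamQ (μ * (L + 1)) ≤ 2 * uQ ^ texp (μ * (L + 1) + 1) := xiQ_sub_gamQ_le _
    _ < Real.exp (-Real.exp (((3 : ℝ) ^ (texp (μ * (L + 1)) + 5)) ^ (μ * (L + 1)))) := approxQ _
    _ ≤ Real.exp (-Real.exp (s ^ μ)) := by
        apply Real.exp_le_exp.mpr; apply neg_le_neg; apply Real.exp_le_exp.mpr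
        calc s ^ μ ≤ ((3 : ℝ) ^ (texp (μ * (L + 1)) + 1 + L)) ^ μ := pow_le_pow_left₀ hs0 hs μ
          _ = (3 : ℝ) ^ ((texp (μ * (L + 1)) + 1 + L) * μ) := by rw [← pow_mul]
          _ ≤ (3 : ℝ) ^ ((texp (μ * (L + 1)) + 5) * (μ * (L + 1))) :=
              pow_le_pow_right₀ (by norm_num) hnat
          _ = ((3 : ℝ) ^ (texp (μ * (L + 1)) + 5)) ^ (μ * (L + 1)) := by rw [← pow_mul]

/-- The rescaled basis `ω₄ / d`. -/
def ωd (d : ℕ) : Fin 4 → ℂ := fun i => ((d : ℂ)⁻¹) * ω4 i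

/-- A tuple with integer coordinate matrix `R` over `ω₄ / d`. -/
def yR {k : ℕ} (R : Fin 4 → Fin k → ℤ) (d : ℕ) : Fin k → ℂ := fun j => ∑ i, (R i j : ℂ) * ωd d i

/-- The transported order-lattice matrix `M₄(A,B) · R`. -/
def MR {k : ℕ} (A B : ℤ) (R : Fin 4 → Fin k → ℤ) : Fin 4 → Fin k → ℤ :=
  fun l j => ∑ i, M4 A B l i * R i j

/-- `‖R‖₁`. -/
def normR {k : ℕ} (R : Fin 4 → Fin k → ℤ) : ℕ := ∑ i, ∑ j, (R i j).natAbs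

/-- Multiplication by `A + B√2` acts on the scaled frame `ωd d = d⁻¹ · ω4` through `M4 A B`. -/
theorem lattice_ωd (A B : ℤ) (d : ℕ) (i : Fin 4) :
    ((A : ℂ) + (B : ℂ) * s2) * ωd d i = ∑ l, (M4 A B l i : ℂ) * ωd d l := by
  unfold ωd
  rw [mul_left_comm, lattice4 A B i, Finset.mul_sum]
  exact Finset.sum_congr rfl fun l _ => by ring

/-- Multiplication by `A + B√2` maps `yR R d` (integer combinations `R` of `ωd d`) into `span_ℤ (ωd d)` through `MR A B R`. -/
theorem latticeR {k : ℕ} (A B : ℤ) (R : Fin 4 → Fin k → ℤ) (d : ℕ) (j : Fin k) :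
    ((A : ℂ) + (B : ℂ) * s2) * yR R d j = ∑ l, (MR A B R l j : ℂ) * ωd d l := by
  calc ((A : ℂ) + (B : ℂ) * s2) * yR R d j
        = ∑ i, (R i j : ℂ) * ((((A : ℂ) + (B : ℂ) * s2)) * ωd d i) := by
          unfold yR; rw [Finset.mul_sum]; exact Finset.sum_congr rfl fun i _ => by ring
    _ = ∑ i, (R i j : ℂ) * ∑ l, (M4 A B l i : ℂ) * ωd d l :=
          Finset.sum_congr rfl fun i _ => by rw [lattice_ωd]
    _ = ∑ i, ∑ l, (R i j : ℂ) * ((M4 A B l i : ℂ) * ωd d l) :=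
          Finset.sum_congr rfl fun i _ => Finset.mul_sum _ _ _
    _ = ∑ l, ∑ i, (R i j : ℂ) * ((M4 A B l i : ℂ) * ωd d l) := Finset.sum_comm
    _ = ∑ l, (MR A B R l j : ℂ) * ωd d l := Finset.sum_congr rfl fun l _ => by
          unfold MR; push_cast; rw [Finset.sum_mul]
          exact Finset.sum_congr rfl fun i _ => by ring

/-- Entries of `M4 A B` are bounded by `2 (|A| + |B|)`. -/
theorem M4_entry_le (A B : ℤ) (l i : Fin 4) : (M4 A B l i).natAbs ≤ 2 * (A.natAbs + B.natAbs) := by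
  have h2B : (2 * B).natAbs = 2 * B.natAbs := by rw [Int.natAbs_mul]; rfl
  fin_cases l <;> fin_cases i <;> simp [M4, h2B] <;> omega

/-- `msize (MR A B R) ≤ 8 · normR R · (|A| + |B|)`. -/
theorem msize_MR_le {k : ℕ} (A B : ℤ) (R : Fin 4 → Fin k → ℤ) :
    msize (MR A B R) ≤ 8 * normR R * (A.natAbs + B.natAbs) := by
  unfold msize MR
  calc ∑ l, ∑ j, (∑ i, M4 A B l i * R i j).natAbs
      ≤ ∑ l, ∑ j, ∑ i, (M4 A B l i).natAbs * (R i j).natAbs := by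
        gcongr with l _ j _
        exact (Int.natAbs_sum_le _ _).trans
          (le_of_eq (Finset.sum_congr rfl fun i _ => Int.natAbs_mul _ _))
    _ ≤ ∑ l : Fin 4, ∑ j, ∑ i, (2 * (A.natAbs + B.natAbs)) * (R i j).natAbs := by
        gcongr with l _ j _ i _
        exact M4_entry_le A B l i
    _ = 4 * ((2 * (A.natAbs + B.natAbs)) * ∑ j, ∑ i, (R i j).natAbs) := by
        rw [Finset.sum_const, Finset.card_univ, Fintype.card_fin, smul_eq_mul]
        congr 1
        rw [Finset.mul_sum]
        exact Finset.sum_congr rfl fun j _ => by rw [Finset.mul_sum]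
    _ = 8 * normR R * (A.natAbs + B.natAbs) := by
        unfold normR; rw [Finset.sum_comm]; ring

/-- The size datum along the tower, robust form: `2 + Σ|M| ≤ 3^{t_m + 1 + L}` with `L = 8‖R‖₁ + 2`. -/
theorem sR_le {k : ℕ} (R : Fin 4 → Fin k → ℤ) (m : ℕ) :
    2 + (msize (MR (AQ m) (BQ m) R) : ℝ) ≤ (3 : ℝ) ^ (texp m + 1 + (8 * normR R + 2)) := by
  have h1 : (msize (MR (AQ m) (BQ m) R) : ℝ) ≤ 8 * normR R * ((AQ m).natAbs + (BQ m).natAbs) := by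
    exact_mod_cast msize_MR_le (AQ m) (BQ m) R
  have h2 : (((AQ m).natAbs + (BQ m).natAbs : ℕ) : ℝ) ≤ (3 : ℝ) ^ (texp m + 1) := by
    have := AB_bound m
    rw [Nat.cast_add, Nat.cast_natAbs, Nat.cast_natAbs]; push_cast; exact_mod_cast this
  have h3 : ((8 * normR R + 2 : ℕ) : ℝ) ≤ (3 : ℝ) ^ (8 * normR R + 2) := by
    exact_mod_cast (Nat.lt_pow_self (by norm_num : 1 < 3) (n := 8 * normR R + 2)).le
  have h4 : (1 : ℝ) ≤ (3 : ℝ) ^ (texp m + 1) := one_le_pow₀ (by norm_num)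
  push_cast at h2 h3
  calc 2 + (msize (MR (AQ m) (BQ m) R) : ℝ)
      ≤ 2 + 8 * normR R * ((AQ m).natAbs + (BQ m).natAbs) := by linarith
    _ ≤ 2 * (3 : ℝ) ^ (texp m + 1) + 8 * normR R * (3 : ℝ) ^ (texp m + 1) := by
        have : (0 : ℝ) ≤ 8 * normR R := by positivity
        nlinarith
    _ = (8 * normR R + 2) * (3 : ℝ) ^ (texp m + 1) := by ring
    _ ≤ (3 : ℝ) ^ (8 * normR R + 2) * (3 : ℝ) ^ (texp m + 1) := by
        apply mul_le_mul_of_nonneg_right h3 (by positivity)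
    _ = (3 : ℝ) ^ (texp m + 1 + (8 * normR R + 2)) := by rw [← pow_add]; ring_nf

/-- **`ξ_Q` is hyper-approximable through the order lattice of `ω₄/d` relative to ANY integer-coordinate
tuple `y_R`** (approximant index `μ (L+1)`, `L = 8‖R‖₁ + 2`). -/
theorem hyperScaleApprox_xiQ_R {k : ℕ} (R : Fin 4 → Fin k → ℤ) (d : ℕ) :
    HyperScaleApprox (ωd d) (yR R d) (xiQ : ℂ) := by
  intro μ
  refine ⟨(gamQ (μ * (8 * normR R + 2 + 1)) : ℂ),
    MR (AQ (μ * (8 * normR R + 2 + 1))) (BQ (μ * (8 * normR R + 2 + 1))) R,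
    by exact_mod_cast (gamQ_pos _).ne', fun j => by rw [gamQ_cast]; exact latticeR _ _ R d j, ?_⟩
  rw [norm_xiQ_sub_gamQ]
  exact xiQ_approx_robust (8 * normR R + 2) μ (by positivity) (sR_le R _)

/-- The scaled frame `ωd d` consists of algebraic numbers. -/
theorem ωd_algebraic {d : ℕ} : ∀ i, IsAlgebraic ℚ (ωd d i) := by
  intro i
  have h : IsAlgebraic ℚ ((d : ℂ)⁻¹) := by
    have := (isAlgebraic_algebraMap (R := ℚ) (A := ℂ) (d : ℚ)).inv
    simpa using this
  exact h.mul (ω4_algebraic i)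

/-- The scaled frame `ωd d` is ℚ-linearly independent for `d > 0`. -/
theorem ωd_linearIndependent {d : ℕ} (hd : 0 < d) : LinearIndependent ℚ (ωd d) :=
  linearIndependent_scale (inv_ne_zero (Nat.cast_ne_zero.mpr hd.ne')) ω4_linearIndependent

/-- If `q.den ∣ D` then `q · D` is an integer. -/
private theorem rat_mul_eq_int_of_den_dvd (q : ℚ) {D : ℕ} (h : q.den ∣ D) : ∃ z : ℤ, (z : ℚ) = q * D := by
  obtain ⟨e, he⟩ := h
  refine ⟨q.num * e, ?_⟩
  rw [he]; push_cast
  rw [← mul_assoc, Rat.mul_den_eq_num]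

/-- **Every tuple drawn from `span_ℚ z_Q⁽⁴⁾ = ξ_Q · ℚ(√2, i)` lies in the scale class.** -/
theorem inScaleClass_of_mem_span_zQ4 {k : ℕ} (w : Fin k → ℂ)
    (hmem : ∀ j, w j ∈ Submodule.span ℚ (Set.range zQ4)) : InScaleClass w := by
  choose c hc using fun j => (Submodule.mem_span_range_iff_exists_fun ℚ).mp (hmem j)
  set d : ℕ := ∏ p : Fin k × Fin 4, (c p.1 p.2).den with hd
  have hdpos : 0 < d := Finset.prod_pos fun p _ => (c p.1 p.2).den_pos
  have hdvd : ∀ j i, (c j i).den ∣ d := fun j i =>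
    Finset.dvd_prod_of_mem (fun p : Fin k × Fin 4 => (c p.1 p.2).den) (Finset.mem_univ (j, i))
  choose R hR using fun (i : Fin 4) (j : Fin k) => rat_mul_eq_int_of_den_dvd (c j i) (hdvd j i)
  refine ⟨4, ωd d, yR R d, xiQ, ωd_algebraic, ωd_linearIndependent hdpos, hyperScaleApprox_xiQ_R R d, ?_⟩
  funext j
  rw [← hc j]
  unfold yR ωd
  rw [Finset.mul_sum]
  refine Finset.sum_congr rfl fun i _ => ?_
  have hd0 : (d : ℂ) ≠ 0 := Nat.cast_ne_zero.mpr hdpos.ne'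
  have hci : (c j i : ℂ) = (R i j : ℂ) * (d : ℂ)⁻¹ := by
    have h' : ((R i j : ℚ) : ℂ) = ((c j i * d : ℚ) : ℂ) := by rw [hR i j]
    push_cast at h'
    rw [h', mul_assoc, mul_inv_cancel₀ hd0, mul_one]
  rw [Rat.smul_def, hci, zQ4]
  ring

/-- **`S` on the whole line:** every ℚ-free tuple (any length) inside `span_ℚ z_Q⁽⁴⁾` satisfies
Schanuel's inequality (mod `hLW`). -/
theorem schanuel_on_line_zQ4 (hLW : LWMeasure) {k : ℕ} (w : Fin k → ℂ) (hw : LinearIndependent ℚ w)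
    (hmem : ∀ j, w j ∈ Submodule.span ℚ (Set.range zQ4)) : SB k w :=
  schanuel_on_scaleClass hLW k w hw (inScaleClass_of_mem_span_zQ4 w hmem)

/-- The induction binder of items 31409/31410 at `z := z_Q⁽⁴⁾`, DISCHARGED (mod `hLW`; all lengths). -/
theorem ih_at_zQ4 (hLW : LWMeasure) :
    ∀ (m : ℕ) (w : Fin m → ℂ), m < 4 → LinearIndependent ℚ w →
      (∀ j, w j ∈ Submodule.span ℚ (Set.range zQ4)) →
      (m : Cardinal) ≤ Algebra.trdeg ℚ ↥(IntermediateField.adjoin ℚ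
        (Set.range w ∪ Set.range (Complex.exp ∘ w))) + 1 :=
  fun _ w _ hw hmem => (schanuel_on_line_zQ4 hLW w hw hmem).trans le_self_add

/-- **Item 31409 `EStableDefectOne` APPLIED to the member `z_Q⁽⁴⁾` with ALL scope hypotheses
discharged** (`zQ4_linearIndependent`, `zQ4_eStable` hypothesis-free; the induction binder by
`ih_at_zQ4`, i.e. mod the tree-proved LW measure). -/
theorem item31409_applied_at_zQ4' (h31409 : Summit.Schanuel.Schanuel.Theses.RootDecomp1E.EStableDefectOne)
    (hLW : LWMeasure) :
    ((4 : ℕ) : Cardinal) ≤ Algebra.trdeg ℚ ↥(IntermediateField.adjoin ℚ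
        (Set.range zQ4 ∪ Set.range (Complex.exp ∘ zQ4))) + 1 :=
  h31409 4 zQ4 zQ4_linearIndependent zQ4_eStable (ih_at_zQ4 hLW)

/-- … and the cell theorem proves that instance outright (mod `hLW`). -/
theorem item31409_instance_at_zQ4' (hLW : LWMeasure) :
    ((4 : ℕ) : Cardinal) ≤ Algebra.trdeg ℚ ↥(IntermediateField.adjoin ℚ
        (Set.range zQ4 ∪ Set.range (Complex.exp ∘ zQ4))) + 1 :=
  eStableDefectOne_scaleCell hLW 4 zQ4 zQ4_linearIndependent zQ4_inScaleClass zQ4_eStable (ih_at_zQ4 hLW)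

end Summit.Schanuel.Schanuel.Theorems.RootDecomp1EScaleTransfer

end
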